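import Mathlib
import HarnessLib
import Literature.Analysis.Calculus.CompIncrementChain
import Summits.HubbardSuperconductivity.HubbardSuperconductivity.Theorems.KLProgrammeKLRegimeSymbolFrameProfileFourth

/-!
# Route `KLProgramme` — crux K3 ENGINE (stmt-HubbardSuperconductivity-20437), stub (b) conj. 2 deep read-out levels, cure «(c-D)² FAMILY TELESCOPE»
# (located finding «(b)-Wt-FAMILY-DEEP», CD-FAMILY.md evidence #55/#58), brick (D2a): the INCREMENT OF THE RADIAL PROFILE between two bands
# `e` and `e − ν` read along a grid line — its value and its first, second and third differences, every term carrying a jet of the piece `ν`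

Cell `gate-hubbard-kl`, seat hubbard-kl-k3c3-p2 (g10).  With `Gₙ(u) = bgmCutoffSq e₀ (16ⁿu)` (`Λ = klScale e₀ n`; all jets vanish above `Λ²`,
`scaleProfile_iteratedDeriv_eq_zero`; jets `|Gₙ^{(k)}| ≤ d e₀^{2k}/Λ^{2k}`, `scaleProfile_chain₄`) the radial factor of a scale-`n` sector multiplier on the band
`e` is `Gₙ(k₀² + e²)`; between the flow frames `K_m` and `K_{m+1} = K_m − ν_m` it changes by
`I(t) = Gₙ(k₀² + (e(t) − ν(t))²) − Gₙ(k₀² + e(t)²) = (Gₙ∘(U + W) − Gₙ∘U)(t)`, `U = k₀² + e²`, `W = −ν(2e − ν)`, along the line `t ↦ p + t·w`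
(`e, ν` and their first three derivatives along the line are the inputs: `|e_i| ≤ E_i` from the frame band, `|ν| ≤ P₀, |ν_i| ≤ P_i` from the
flow-piece jets).  SUPPORT LOCALISATION: every member of the increment chain vanishes unless `|e(t)| ≤ Λ + P₀`, so the band VALUE enters only through
`E₀ := Λ + P₀` (the profile's own scale), never through `sup|e|`.

* `profileIncr_curves_hasDerivAt`, `profileIncr_curves_bounds` — the derivatives `U₁, U₂, U₃`, `W₁, W₂, W₃` along the line (`HasDerivAt` links) and
  their pointwise bounds on `{|e| ≤ E₀}`; `profileIncr_jets_eq_zero_of_far` — off `{|e| ≤ Λ + P₀}` every jet of `Gₙ` vanishes at both arguments;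
* **`norm_fwdDiff_iter_profileIncr_le`** — `‖Δ_δ^k I(t)‖ ≤ δ^k·𝔅_k` (`k = 0, 1, 2, 3` as four conjuncts, `δ ≥ 0`) with `𝔅_k` the bound of
  `Literature.Analysis.Calculus.norm_comp_incr_deriv{k}_le` at the data
  `C_k = d e₀^{2k}/Λ^{2k}`, `D₁ = 2E₀E₁`, `D₂ = 2(E₁² + E₀E₂)`, `D₃ = 2(3E₁E₂ + E₀E₃)`, `W₀ = P₀(2E₀ + P₀)`, `W₁ = 2(E₁P₀ + E₀P₁ + P₀P₁)`,
  `W₂ = 2(E₂P₀ + 2E₁P₁ + E₀P₂ + P₁² + P₀P₂)`, `W₃ = 2(E₃P₀ + 3E₂P₁ + 3E₁P₂ + E₀P₃ + 3P₁P₂ + P₀P₃)` — EVERY monomial carries a `P`.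

This is the per-line input of the multiplier-increment pair data (brick (D2b/c)); the time direction is the same lemma with `ν` constant along the line.
Everything is proved; no definitions, no sorry.  Nothing asserts superconductivity. [cite: BenfattoGiulianiMastropietro2006, §2.5 (2.53), §3 (3.2)–(3.8)]
-/

noncomputable section

namespace Summit.HubbardSuperconductivity.HubbardSuperconductivity.Theorems.TorusFourierL2

set_option linter.dupNamespace false -- summit = problem name (single-conjunct summit), D-0017

open Set Literature.MathematicalPhysics.QuantumLattice Literature.MathematicalPhysics.QuantumLattice.FermiRG
open Literature.Probability.LatticeModels Literature.Analysis.Calculus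
open Summit.HubbardSuperconductivity.HubbardSuperconductivity.Theorems.KLRegimeSplit
open Summit.HubbardSuperconductivity.HubbardSuperconductivity.Theorems.KLProgrammeLegKernels

section ProfileIncr

variable {e₀ : ℝ} (he : 0 < e₀) (n : ℕ) {d : ℝ} (hd1 : ∀ u, |deriv (bgmCutoffSq e₀) u| ≤ d)
  (hd2 : ∀ u, |iteratedDeriv 2 (bgmCutoffSq e₀) u| ≤ d) (hd3 : ∀ u, |iteratedDeriv 3 (bgmCutoffSq e₀) u| ≤ d)
  (hd4 : ∀ u, |iteratedDeriv 4 (bgmCutoffSq e₀) u| ≤ d)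
  (k₀ : ℝ) {e e₁ e₂ e₃ ν ν₁ ν₂ ν₃ : ℝ → ℝ}
  (he' : ∀ t, HasDerivAt e (e₁ t) t) (he₁ : ∀ t, HasDerivAt e₁ (e₂ t) t) (he₂ : ∀ t, HasDerivAt e₂ (e₃ t) t)
  (hν : ∀ t, HasDerivAt ν (ν₁ t) t) (hν₁ : ∀ t, HasDerivAt ν₁ (ν₂ t) t) (hν₂ : ∀ t, HasDerivAt ν₂ (ν₃ t) t)
  {E₁ E₂ E₃ P₀ P₁ P₂ P₃ : ℝ} (hE₁ : ∀ t, |e₁ t| ≤ E₁) (hE₂ : ∀ t, |e₂ t| ≤ E₂) (hE₃ : ∀ t, |e₃ t| ≤ E₃)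
  (hP₀ : ∀ t, |ν t| ≤ P₀) (hP₁ : ∀ t, |ν₁ t| ≤ P₁) (hP₂ : ∀ t, |ν₂ t| ≤ P₂) (hP₃ : ∀ t, |ν₃ t| ≤ P₃)

/-! ### §1 The curves `U = k₀² + e²`, `W = −ν(2e − ν)` along the line: derivatives and localised bounds -/

include he' he₁ he₂ hν hν₁ hν₂ in
/-- **The inner curves of the profile increment**: `U = k₀² + e²` has derivatives `U₁ = 2ee₁`, `U₂ = 2(e₁² + ee₂)`, `U₃ = 2(3e₁e₂ + ee₃)` and
`W = −ν(2e−ν)` has `W₁ = −2(e₁ν + eν₁) + 2νν₁`, `W₂ = −2(e₂ν + 2e₁ν₁ + eν₂) + 2(ν₁² + νν₂)`, `W₃ = −2(e₃ν + 3e₂ν₁ + 3e₁ν₂ + eν₃) + 2(3ν₁ν₂ + νν₃)`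
(`HasDerivAt` links along the line). [cite: BenfattoGiulianiMastropietro2006, §3 (3.2)] -/
theorem profileIncr_curves_hasDerivAt :
    (∀ t, HasDerivAt (fun t => k₀ ^ 2 + e t ^ 2) (2 * e t * e₁ t) t) ∧
    (∀ t, HasDerivAt (fun t => 2 * e t * e₁ t) (2 * (e₁ t ^ 2 + e t * e₂ t)) t) ∧
    (∀ t, HasDerivAt (fun t => 2 * (e₁ t ^ 2 + e t * e₂ t)) (2 * (3 * e₁ t * e₂ t + e t * e₃ t)) t) ∧
    (∀ t, HasDerivAt (fun t => -(ν t * (2 * e t - ν t))) (-2 * (e₁ t * ν t + e t * ν₁ t) + 2 * ν t * ν₁ t) t) ∧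
    (∀ t, HasDerivAt (fun t => -2 * (e₁ t * ν t + e t * ν₁ t) + 2 * ν t * ν₁ t)
      (-2 * (e₂ t * ν t + 2 * e₁ t * ν₁ t + e t * ν₂ t) + 2 * (ν₁ t ^ 2 + ν t * ν₂ t)) t) ∧
    (∀ t, HasDerivAt (fun t => -2 * (e₂ t * ν t + 2 * e₁ t * ν₁ t + e t * ν₂ t) + 2 * (ν₁ t ^ 2 + ν t * ν₂ t))
      (-2 * (e₃ t * ν t + 3 * e₂ t * ν₁ t + 3 * e₁ t * ν₂ t + e t * ν₃ t) + 2 * (3 * ν₁ t * ν₂ t + ν t * ν₃ t)) t) := by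
  -- generic: a `HasDerivAt` statement is insensitive to pointwise-`ring` rewrites of the function and of the derivative value
  have key : ∀ {f g : ℝ → ℝ} {f' g' t : ℝ}, HasDerivAt f f' t → (∀ s, g s = f s) → g' = f' → HasDerivAt g g' t := by
    intro f g f' g' t h hfg hd
    have hfg' : g = f := funext hfg
    rw [hfg', hd]; exact h
  refine ⟨fun t => ?_, fun t => ?_, fun t => ?_, fun t => ?_, fun t => ?_, fun t => ?_⟩
  · exact key (((he' t).fun_mul (he' t)).const_add (k₀ ^ 2)) (fun s => by ring) (by ring)
  · exact key (((he' t).fun_mul (he₁ t)).const_mul 2) (fun s => by ring) (by ring)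
  · exact key ((((he₁ t).fun_mul (he₁ t)).fun_add ((he' t).fun_mul (he₂ t))).const_mul 2) (fun s => by ring) (by ring)
  · exact key (((hν t).fun_mul (((he' t).const_mul 2).fun_sub (hν t))).fun_neg) (fun s => by ring) (by ring)
  · exact key (((((he₁ t).fun_mul (hν t)).fun_add ((he' t).fun_mul (hν₁ t))).const_mul (-2)).fun_add
      (((hν t).fun_mul (hν₁ t)).const_mul 2)) (fun s => by ring) (by ring)
  · exact key ((((((he₂ t).fun_mul (hν t)).fun_add (((he₁ t).fun_mul (hν₁ t)).const_mul 2)).fun_add ((he' t).fun_mul (hν₂ t))).const_mul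
      (-2)).fun_add ((((hν₁ t).fun_mul (hν₁ t)).fun_add ((hν t).fun_mul (hν₂ t))).const_mul 2)) (fun s => by ring) (by ring)

include hE₁ hE₂ hE₃ hP₀ hP₁ hP₂ hP₃ in
/-- **Localised bounds of the inner curves**: at a point `t` with `|e t| ≤ E₀`:
`|U₁| ≤ 2E₀E₁`, `|U₂| ≤ 2(E₁² + E₀E₂)`, `|U₃| ≤ 2(3E₁E₂ + E₀E₃)`, `|W| ≤ P₀(2E₀ + P₀)`, `|W₁| ≤ 2(E₁P₀ + E₀P₁ + P₀P₁)`,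
`|W₂| ≤ 2(E₂P₀ + 2E₁P₁ + E₀P₂ + P₁² + P₀P₂)`, `|W₃| ≤ 2(E₃P₀ + 3E₂P₁ + 3E₁P₂ + E₀P₃ + 3P₁P₂ + P₀P₃)`. [cite: BenfattoGiulianiMastropietro2006, §3 (3.2)] -/
theorem profileIncr_curves_bounds {E₀ : ℝ} {t : ℝ} (ht : |e t| ≤ E₀) :
    |2 * e t * e₁ t| ≤ 2 * E₀ * E₁ ∧ |2 * (e₁ t ^ 2 + e t * e₂ t)| ≤ 2 * (E₁ ^ 2 + E₀ * E₂) ∧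
    |2 * (3 * e₁ t * e₂ t + e t * e₃ t)| ≤ 2 * (3 * E₁ * E₂ + E₀ * E₃) ∧
    |(-(ν t * (2 * e t - ν t)))| ≤ P₀ * (2 * E₀ + P₀) ∧
    |(-2 * (e₁ t * ν t + e t * ν₁ t) + 2 * ν t * ν₁ t)| ≤ 2 * (E₁ * P₀ + E₀ * P₁ + P₀ * P₁) ∧
    |(-2 * (e₂ t * ν t + 2 * e₁ t * ν₁ t + e t * ν₂ t) + 2 * (ν₁ t ^ 2 + ν t * ν₂ t))| ≤ 2 * (E₂ * P₀ + 2 * E₁ * P₁ + E₀ * P₂ + P₁ ^ 2 + P₀ * P₂) ∧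
    |(-2 * (e₃ t * ν t + 3 * e₂ t * ν₁ t + 3 * e₁ t * ν₂ t + e t * ν₃ t) + 2 * (3 * ν₁ t * ν₂ t + ν t * ν₃ t))| ≤
      2 * (E₃ * P₀ + 3 * E₂ * P₁ + 3 * E₁ * P₂ + E₀ * P₃ + 3 * P₁ * P₂ + P₀ * P₃) := by
  have a0 := ht; have a1 := hE₁ t; have a2 := hE₂ t; have a3 := hE₃ t
  have b0 := hP₀ t; have b1 := hP₁ t; have b2 := hP₂ t; have b3 := hP₃ t
  have hE0 : 0 ≤ E₀ := (abs_nonneg _).trans a0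
  have hE1 : 0 ≤ E₁ := (abs_nonneg _).trans a1
  have hE2 : 0 ≤ E₂ := (abs_nonneg _).trans a2
  have hP0 : 0 ≤ P₀ := (abs_nonneg _).trans b0
  have hP1 : 0 ≤ P₁ := (abs_nonneg _).trans b1
  have hP2 : 0 ≤ P₂ := (abs_nonneg _).trans b2
  -- products of absolute values
  have m := fun (x y X Y : ℝ) (hx : |x| ≤ X) (hy : |y| ≤ Y) => (abs_mul x y).le.trans (mul_le_mul hx hy (abs_nonneg _) ((abs_nonneg _).trans hx))
  refine ⟨?_, ?_, ?_, ?_, ?_, ?_, ?_⟩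
  · rw [abs_mul, abs_mul, abs_two]; nlinarith [m _ _ _ _ a0 a1, abs_nonneg (e t), abs_nonneg (e₁ t)]
  · rw [abs_mul, abs_two]
    have h1 : |e₁ t ^ 2 + e t * e₂ t| ≤ E₁ ^ 2 + E₀ * E₂ := by
      refine (abs_add_le _ _).trans (add_le_add ?_ (m _ _ _ _ a0 a2))
      rw [abs_pow]; exact pow_le_pow_left₀ (abs_nonneg _) a1 2
    linarith
  · rw [abs_mul, abs_two]
    have h1 : |3 * e₁ t * e₂ t + e t * e₃ t| ≤ 3 * E₁ * E₂ + E₀ * E₃ := by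
      refine (abs_add_le _ _).trans (add_le_add ?_ (m _ _ _ _ a0 a3))
      rw [mul_assoc, abs_mul, abs_of_pos (by norm_num : (0:ℝ) < 3), mul_assoc]
      exact mul_le_mul_of_nonneg_left (m _ _ _ _ a1 a2) (by norm_num)
    linarith
  · rw [abs_neg, abs_mul]
    refine mul_le_mul b0 ((abs_sub _ _).trans ?_) (abs_nonneg _) hP0
    rw [abs_mul, abs_two]; linarith
  · have h1 : |e₁ t * ν t + e t * ν₁ t| ≤ E₁ * P₀ + E₀ * P₁ := (abs_add_le _ _).trans (add_le_add (m _ _ _ _ a1 b0) (m _ _ _ _ a0 b1))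
    have h2 : |ν t * ν₁ t| ≤ P₀ * P₁ := m _ _ _ _ b0 b1
    calc _ ≤ |(-2) * (e₁ t * ν t + e t * ν₁ t)| + |2 * ν t * ν₁ t| := abs_add_le _ _
      _ ≤ 2 * (E₁ * P₀ + E₀ * P₁) + 2 * (P₀ * P₁) := by
          rw [abs_mul, abs_neg, abs_two, mul_assoc, abs_mul (2:ℝ), abs_two]
          exact add_le_add (mul_le_mul_of_nonneg_left h1 (by norm_num)) (mul_le_mul_of_nonneg_left h2 (by norm_num))
      _ = _ := by ring
  · have h1 : |e₂ t * ν t + 2 * e₁ t * ν₁ t + e t * ν₂ t| ≤ E₂ * P₀ + 2 * E₁ * P₁ + E₀ * P₂ := by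
      refine (abs_add_le _ _).trans (add_le_add ((abs_add_le _ _).trans (add_le_add (m _ _ _ _ a2 b0) ?_)) (m _ _ _ _ a0 b2))
      rw [mul_assoc, abs_mul, abs_two, mul_assoc]; exact mul_le_mul_of_nonneg_left (m _ _ _ _ a1 b1) (by norm_num)
    have h2 : |ν₁ t ^ 2 + ν t * ν₂ t| ≤ P₁ ^ 2 + P₀ * P₂ := by
      refine (abs_add_le _ _).trans (add_le_add ?_ (m _ _ _ _ b0 b2))
      rw [abs_pow]; exact pow_le_pow_left₀ (abs_nonneg _) b1 2
    calc _ ≤ |(-2) * (e₂ t * ν t + 2 * e₁ t * ν₁ t + e t * ν₂ t)| + |2 * (ν₁ t ^ 2 + ν t * ν₂ t)| := abs_add_le _ _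
      _ ≤ 2 * (E₂ * P₀ + 2 * E₁ * P₁ + E₀ * P₂) + 2 * (P₁ ^ 2 + P₀ * P₂) := by
          rw [abs_mul, abs_neg, abs_two, abs_mul (2:ℝ), abs_two]
          exact add_le_add (mul_le_mul_of_nonneg_left h1 (by norm_num)) (mul_le_mul_of_nonneg_left h2 (by norm_num))
      _ = _ := by ring
  · have h1 : |e₃ t * ν t + 3 * e₂ t * ν₁ t + 3 * e₁ t * ν₂ t + e t * ν₃ t| ≤ E₃ * P₀ + 3 * E₂ * P₁ + 3 * E₁ * P₂ + E₀ * P₃ := by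
      refine (abs_add_le _ _).trans (add_le_add ((abs_add_le _ _).trans (add_le_add ((abs_add_le _ _).trans
        (add_le_add (m _ _ _ _ a3 b0) ?_)) ?_)) (m _ _ _ _ a0 b3))
      · rw [mul_assoc, abs_mul, abs_of_pos (by norm_num : (0:ℝ) < 3), mul_assoc]
        exact mul_le_mul_of_nonneg_left (m _ _ _ _ a2 b1) (by norm_num)
      · rw [mul_assoc, abs_mul, abs_of_pos (by norm_num : (0:ℝ) < 3), mul_assoc]
        exact mul_le_mul_of_nonneg_left (m _ _ _ _ a1 b2) (by norm_num)
    have h2 : |3 * ν₁ t * ν₂ t + ν t * ν₃ t| ≤ 3 * P₁ * P₂ + P₀ * P₃ := by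
      refine (abs_add_le _ _).trans (add_le_add ?_ (m _ _ _ _ b0 b3))
      rw [mul_assoc, abs_mul, abs_of_pos (by norm_num : (0:ℝ) < 3), mul_assoc]
      exact mul_le_mul_of_nonneg_left (m _ _ _ _ b1 b2) (by norm_num)
    calc _ ≤ |(-2) * (e₃ t * ν t + 3 * e₂ t * ν₁ t + 3 * e₁ t * ν₂ t + e t * ν₃ t)| + |2 * (3 * ν₁ t * ν₂ t + ν t * ν₃ t)| := abs_add_le _ _
      _ ≤ 2 * (E₃ * P₀ + 3 * E₂ * P₁ + 3 * E₁ * P₂ + E₀ * P₃) + 2 * (3 * P₁ * P₂ + P₀ * P₃) := by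
          rw [abs_mul, abs_neg, abs_two, abs_mul (2:ℝ), abs_two]
          exact add_le_add (mul_le_mul_of_nonneg_left h1 (by norm_num)) (mul_le_mul_of_nonneg_left h2 (by norm_num))
      _ = _ := by ring

/-! ### §2 Support localisation: outside `{|e| ≤ Λ + P₀}` both profiles and all their jets vanish -/

include he hP₀ in
/-- **Localisation**: if `|e t| > Λ + P₀` then `k₀² + (e t)² > Λ²` and `k₀² + (e t − ν t)² > Λ²`, so every jet of `Gₙ` vanishes at both arguments.
[cite: BenfattoGiulianiMastropietro2006, §2.5 (2.53)] -/
theorem profileIncr_jets_eq_zero_of_far {t : ℝ} (ht : klScale e₀ n + P₀ < |e t|) (k : ℕ) :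
    iteratedDeriv k (fun u => bgmCutoffSq e₀ ((16 : ℝ) ^ n * u)) (k₀ ^ 2 + e t ^ 2) = 0 ∧
    iteratedDeriv k (fun u => bgmCutoffSq e₀ ((16 : ℝ) ^ n * u)) (k₀ ^ 2 + e t ^ 2 + -(ν t * (2 * e t - ν t))) = 0 := by
  have hΛ : 0 < klScale e₀ n := by rw [klScale]; positivity
  have hP0 : 0 ≤ P₀ := (abs_nonneg _).trans (hP₀ t)
  have h1 : klScale e₀ n < |e t| := by linarith
  have h2 : klScale e₀ n < |e t - ν t| := by
    have := abs_sub_abs_le_abs_sub (e t) (ν t)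
    linarith [hP₀ t]
  have sq1 : klScale e₀ n ^ 2 < k₀ ^ 2 + e t ^ 2 := by
    have : klScale e₀ n ^ 2 < |e t| ^ 2 := by gcongr
    rw [sq_abs] at this; nlinarith [sq_nonneg k₀]
  have sq2 : klScale e₀ n ^ 2 < k₀ ^ 2 + e t ^ 2 + -(ν t * (2 * e t - ν t)) := by
    have : klScale e₀ n ^ 2 < |e t - ν t| ^ 2 := by gcongr
    rw [sq_abs] at this; nlinarith [sq_nonneg k₀]
  exact ⟨scaleProfile_iteratedDeriv_eq_zero he n k sq1, scaleProfile_iteratedDeriv_eq_zero he n k sq2⟩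


/-! ### §3 The increment chain: pointwise bounds of its members (localised) and the differences of the increment -/
set_option maxHeartbeats 400000 in
include he hd1 hd2 hd3 hd4 he' he₁ he₂ hν hν₁ hν₂ hE₁ hE₂ hE₃ hP₀ hP₁ hP₂ hP₃ in
/-- **The differences of the profile increment along the line, orders `0 … 3`.**  With `Λ = klScale e₀ n`, `E₀ = Λ + P₀`, `C_k = d e₀^{2k}/Λ^{2k}` and the
data `D₁ D₂ D₃ W₀ W₁ W₂ W₃` of `profileIncr_curves_bounds` (abbreviation hypotheses, instantiate with `rfl`), for every `δ ≥ 0` and every `t`: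
`‖I(t)‖ ≤ C₁W₀`, `‖Δ_δ I(t)‖ ≤ δ(C₂W₀(D₁+W₁) + C₁W₁)`, `‖Δ_δ² I(t)‖ ≤ δ²(C₃W₀(D₁+W₁)² + C₂W₁(2D₁+W₁) + C₂W₀(D₂+W₂) + C₁W₂)`,
`‖Δ_δ³ I(t)‖ ≤ δ³(C₄W₀(D₁+W₁)³ + C₃W₁(3D₁²+3D₁W₁+W₁²) + 3(C₃W₀(D₁+W₁)(D₂+W₂) + C₂(D₁W₂+W₁D₂+W₁W₂)) + C₂W₀(D₃+W₃) + C₁W₃)`,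
`I(s) = Gₙ(k₀² + (e s − ν s)²) − Gₙ(k₀² + (e s)²)` (as a complex number). [cite: BenfattoGiulianiMastropietro2006, §3 (3.2)–(3.8)] -/
theorem norm_fwdDiff_iter_profileIncr_le {E₀ C₁ C₂ C₃ C₄ D₁ D₂ D₃ W₀ W₁ W₂ W₃ : ℝ} (hE₀ : E₀ = klScale e₀ n + P₀)
    (hC₁ : C₁ = d * e₀ ^ 2 / klScale e₀ n ^ 2) (hC₂ : C₂ = d * e₀ ^ 4 / klScale e₀ n ^ 4) (hC₃ : C₃ = d * e₀ ^ 6 / klScale e₀ n ^ 6)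
    (hC₄ : C₄ = d * e₀ ^ 8 / klScale e₀ n ^ 8)
    (hD₁ : D₁ = 2 * E₀ * E₁) (hD₂ : D₂ = 2 * (E₁ ^ 2 + E₀ * E₂)) (hD₃ : D₃ = 2 * (3 * E₁ * E₂ + E₀ * E₃))
    (hW₀ : W₀ = P₀ * (2 * E₀ + P₀)) (hW₁ : W₁ = 2 * (E₁ * P₀ + E₀ * P₁ + P₀ * P₁))
    (hW₂ : W₂ = 2 * (E₂ * P₀ + 2 * E₁ * P₁ + E₀ * P₂ + P₁ ^ 2 + P₀ * P₂))
    (hW₃ : W₃ = 2 * (E₃ * P₀ + 3 * E₂ * P₁ + 3 * E₁ * P₂ + E₀ * P₃ + 3 * P₁ * P₂ + P₀ * P₃)) {δ : ℝ} (hδ : 0 ≤ δ) (t : ℝ) :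
    ‖((bgmCutoffSq e₀ ((16 : ℝ) ^ n * (k₀ ^ 2 + (e t - ν t) ^ 2)) : ℝ) : ℂ) - ((bgmCutoffSq e₀ ((16 : ℝ) ^ n * (k₀ ^ 2 + e t ^ 2)) : ℝ) : ℂ)‖ ≤
        C₁ * W₀ ∧
    ‖fwdDiff δ (fun s => ((bgmCutoffSq e₀ ((16 : ℝ) ^ n * (k₀ ^ 2 + (e s - ν s) ^ 2)) : ℝ) : ℂ) -
        ((bgmCutoffSq e₀ ((16 : ℝ) ^ n * (k₀ ^ 2 + e s ^ 2)) : ℝ) : ℂ)) t‖ ≤ δ * (C₂ * W₀ * (D₁ + W₁) + C₁ * W₁) ∧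
    ‖(fwdDiff δ)^[2] (fun s => ((bgmCutoffSq e₀ ((16 : ℝ) ^ n * (k₀ ^ 2 + (e s - ν s) ^ 2)) : ℝ) : ℂ) -
        ((bgmCutoffSq e₀ ((16 : ℝ) ^ n * (k₀ ^ 2 + e s ^ 2)) : ℝ) : ℂ)) t‖ ≤
      δ ^ 2 * (C₃ * W₀ * (D₁ + W₁) ^ 2 + C₂ * (W₁ * (2 * D₁ + W₁)) + (C₂ * W₀ * (D₂ + W₂) + C₁ * W₂)) ∧
    ‖(fwdDiff δ)^[3] (fun s => ((bgmCutoffSq e₀ ((16 : ℝ) ^ n * (k₀ ^ 2 + (e s - ν s) ^ 2)) : ℝ) : ℂ) -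
        ((bgmCutoffSq e₀ ((16 : ℝ) ^ n * (k₀ ^ 2 + e s ^ 2)) : ℝ) : ℂ)) t‖ ≤
      δ ^ 3 * (C₄ * W₀ * (D₁ + W₁) ^ 3 + C₃ * (W₁ * (3 * D₁ ^ 2 + 3 * D₁ * W₁ + W₁ ^ 2)) +
        3 * (C₃ * W₀ * ((D₁ + W₁) * (D₂ + W₂)) + C₂ * (D₁ * W₂ + W₁ * D₂ + W₁ * W₂)) + (C₂ * W₀ * (D₃ + W₃) + C₁ * W₃)) := by
  have hΛ : 0 < klScale e₀ n := by rw [klScale]; positivity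
  have hd0 : 0 ≤ d := (abs_nonneg _).trans (hd1 0)
  have hE1 : 0 ≤ E₁ := (abs_nonneg _).trans (hE₁ 0)
  have hE2 : 0 ≤ E₂ := (abs_nonneg _).trans (hE₂ 0)
  have hE3 : 0 ≤ E₃ := (abs_nonneg _).trans (hE₃ 0)
  have hP0 : 0 ≤ P₀ := (abs_nonneg _).trans (hP₀ 0)
  have hP1 : 0 ≤ P₁ := (abs_nonneg _).trans (hP₁ 0)
  have hP2 : 0 ≤ P₂ := (abs_nonneg _).trans (hP₂ 0)
  have hP3 : 0 ≤ P₃ := (abs_nonneg _).trans (hP₃ 0)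
  have hE0 : 0 ≤ E₀ := by rw [hE₀]; positivity
  have c1 : 0 ≤ C₁ := by rw [hC₁]; positivity
  have c2 : 0 ≤ C₂ := by rw [hC₂]; positivity
  have c3 : 0 ≤ C₃ := by rw [hC₃]; positivity
  have c4 : 0 ≤ C₄ := by rw [hC₄]; positivity
  have d1 : 0 ≤ D₁ := by rw [hD₁]; positivity
  have d2 : 0 ≤ D₂ := by rw [hD₂]; positivity
  have d3 : 0 ≤ D₃ := by rw [hD₃]; positivity
  have w0 : 0 ≤ W₀ := by rw [hW₀]; positivity
  have w1 : 0 ≤ W₁ := by rw [hW₁]; positivity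
  have w2 : 0 ≤ W₂ := by rw [hW₂]; positivity
  have w3 : 0 ≤ W₃ := by rw [hW₃]; positivity
  -- the outer function and its jets
  set G : ℝ → ℝ := (fun u => bgmCutoffSq e₀ ((16 : ℝ) ^ n * u)) with hG
  set g₀ : ℝ → ℂ := fun u => ((G u : ℝ) : ℂ) with hg₀
  set g₁ : ℝ → ℂ := fun u => ((iteratedDeriv 1 G u : ℝ) : ℂ) with hg₁
  set g₂ : ℝ → ℂ := fun u => ((iteratedDeriv 2 G u : ℝ) : ℂ) with hg₂
  set g₃ : ℝ → ℂ := fun u => ((iteratedDeriv 3 G u : ℝ) : ℂ) with hg₃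
  obtain ⟨hlink, n0, n1, n2, n3, n4, i0, i1, i2, i3⟩ := scaleProfile_chain₄ he n hd1 hd2 hd3 hd4
  have hg : ∀ x, HasDerivAt g₀ (g₁ x) x := by
    intro x; have h := hlink 0 (by norm_num) x; simpa [hg₀, hg₁, hG] using h
  have hg₁' : ∀ x, HasDerivAt g₁ (g₂ x) x := fun x => hlink 1 (by norm_num) x
  have hg₂' : ∀ x, HasDerivAt g₂ (g₃ x) x := fun x => hlink 2 (by norm_num) x
  have h₁ : ∀ x, ‖g₁ x‖ ≤ C₁ := by intro x; rw [hC₁]; exact n1 x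
  have h₂ : ∀ x, ‖g₂ x‖ ≤ C₂ := by intro x; rw [hC₂]; exact n2 x
  have h₃ : ∀ x, ‖g₃ x‖ ≤ C₃ := by intro x; rw [hC₃]; exact n3 x
  have j₀ : ∀ x y, ‖g₀ (x + y) - g₀ x‖ ≤ C₁ * |y| := by
    intro x y; rw [hC₁]; have h := i0 x y; simpa [hg₀, hG] using h
  have j₁ : ∀ x y, ‖g₁ (x + y) - g₁ x‖ ≤ C₂ * |y| := by intro x y; rw [hC₂]; exact i1 x y
  have j₂ : ∀ x y, ‖g₂ (x + y) - g₂ x‖ ≤ C₃ * |y| := by intro x y; rw [hC₃]; exact i2 x y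
  have j₃ : ∀ x y, ‖g₃ (x + y) - g₃ x‖ ≤ C₄ * |y| := by intro x y; rw [hC₄]; exact i3 x y
  -- the inner curves
  set U : ℝ → ℝ := fun s => k₀ ^ 2 + e s ^ 2 with hU
  set U₁ : ℝ → ℝ := fun s => 2 * e s * e₁ s with hU₁
  set U₂ : ℝ → ℝ := fun s => 2 * (e₁ s ^ 2 + e s * e₂ s) with hU₂
  set U₃ : ℝ → ℝ := fun s => 2 * (3 * e₁ s * e₂ s + e s * e₃ s) with hU₃
  set W : ℝ → ℝ := fun s => -(ν s * (2 * e s - ν s)) with hW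
  set V₁ : ℝ → ℝ := fun s => -2 * (e₁ s * ν s + e s * ν₁ s) + 2 * ν s * ν₁ s with hV₁
  set V₂ : ℝ → ℝ := fun s => -2 * (e₂ s * ν s + 2 * e₁ s * ν₁ s + e s * ν₂ s) + 2 * (ν₁ s ^ 2 + ν s * ν₂ s) with hV₂
  set V₃ : ℝ → ℝ := fun s => -2 * (e₃ s * ν s + 3 * e₂ s * ν₁ s + 3 * e₁ s * ν₂ s + e s * ν₃ s) + 2 * (3 * ν₁ s * ν₂ s + ν s * ν₃ s) with hV₃
  obtain ⟨hU', hU₁', hU₂', hW', hV₁', hV₂'⟩ := profileIncr_curves_hasDerivAt k₀ he' he₁ he₂ hν hν₁ hν₂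
  -- the chain of the increment
  set H : ℕ → ℝ → ℂ := fun k t =>
      if k = 0 then g₀ (U t + W t) - g₀ (U t)
      else if k = 1 then g₁ (U t + W t) * ((U₁ t + V₁ t : ℝ) : ℂ) - g₁ (U t) * (U₁ t : ℂ)
      else if k = 2 then (g₂ (U t + W t) * ((U₁ t + V₁ t : ℝ) : ℂ) ^ 2 + g₁ (U t + W t) * ((U₂ t + V₂ t : ℝ) : ℂ)) -
        (g₂ (U t) * (U₁ t : ℂ) ^ 2 + g₁ (U t) * (U₂ t : ℂ))
      else if k = 3 then (g₃ (U t + W t) * ((U₁ t + V₁ t : ℝ) : ℂ) ^ 3 + 3 * (g₂ (U t + W t) * ((U₁ t + V₁ t : ℝ) : ℂ) *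
          ((U₂ t + V₂ t : ℝ) : ℂ)) + g₁ (U t + W t) * ((U₃ t + V₃ t : ℝ) : ℂ)) -
        (g₃ (U t) * (U₁ t : ℂ) ^ 3 + 3 * (g₂ (U t) * (U₁ t : ℂ) * (U₂ t : ℂ)) + g₁ (U t) * (U₃ t : ℂ))
      else 0 with hH
  have hchain : ∀ k < 3, ∀ t, HasDerivAt (H k) (H (k + 1) t) t :=
    hasDerivAt_comp_incr_chain hg hg₁' hg₂' hU' hU₁' hU₂' hW' hV₁' hV₂'
  -- the increment as written in the statement is `H 0`
  have hI : (fun s => ((bgmCutoffSq e₀ ((16 : ℝ) ^ n * (k₀ ^ 2 + (e s - ν s) ^ 2)) : ℝ) : ℂ) -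
      ((bgmCutoffSq e₀ ((16 : ℝ) ^ n * (k₀ ^ 2 + e s ^ 2)) : ℝ) : ℂ)) = H 0 := by
    funext s
    have e1 : k₀ ^ 2 + (e s - ν s) ^ 2 = U s + W s := by simp only [hU, hW]; ring
    simp only [hH, hg₀, hG, if_true]
    rw [e1]
  -- localisation: far from the shell every jet vanishes at both arguments
  have far : ∀ s, ¬ |e s| ≤ E₀ → ∀ k, iteratedDeriv k G (U s) = 0 ∧ iteratedDeriv k G (U s + W s) = 0 := by
    intro s hs k
    rw [not_le, hE₀] at hs
    exact profileIncr_jets_eq_zero_of_far he n k₀ hP₀ hs k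
  -- pointwise bounds of the members
  have B0 : ∀ s, ‖H 0 s‖ ≤ C₁ * W₀ := by
    intro s
    have h0 : H 0 s = g₀ (U s + W s) - g₀ (U s) := by simp [hH]
    rw [h0]
    by_cases hs : |e s| ≤ E₀
    · obtain ⟨-, -, -, bW, -, -, -⟩ := profileIncr_curves_bounds hE₁ hE₂ hE₃ hP₀ hP₁ hP₂ hP₃ hs
      rw [← hW₀] at bW
      exact norm_comp_incr_le j₀ bW
    · have z1 := (far s hs 0).1; have z2 := (far s hs 0).2
      rw [iteratedDeriv_zero] at z1 z2
      have : g₀ (U s + W s) - g₀ (U s) = 0 := by simp only [hg₀, z1, z2]; simp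
      rw [this, norm_zero]; positivity
  have B1 : ∀ s, ‖H 1 s‖ ≤ C₂ * W₀ * (D₁ + W₁) + C₁ * W₁ := by
    intro s
    have h1 : H 1 s = g₁ (U s + W s) * ((U₁ s + V₁ s : ℝ) : ℂ) - g₁ (U s) * (U₁ s : ℂ) := by simp [hH]
    rw [h1]
    by_cases hs : |e s| ≤ E₀
    · obtain ⟨bU₁, -, -, bW, bV₁, -, -⟩ := profileIncr_curves_bounds hE₁ hE₂ hE₃ hP₀ hP₁ hP₂ hP₃ hs
      rw [← hD₁] at bU₁; rw [← hW₀] at bW; rw [← hW₁] at bV₁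
      exact norm_comp_incr_deriv1_le h₁ j₁ bU₁ bW bV₁
    · have z1 := (far s hs 1).1; have z2 := (far s hs 1).2
      have : g₁ (U s + W s) * ((U₁ s + V₁ s : ℝ) : ℂ) - g₁ (U s) * (U₁ s : ℂ) = 0 := by simp only [hg₁, z1, z2]; simp
      rw [this, norm_zero]; positivity
  have B2 : ∀ s, ‖H 2 s‖ ≤ C₃ * W₀ * (D₁ + W₁) ^ 2 + C₂ * (W₁ * (2 * D₁ + W₁)) + (C₂ * W₀ * (D₂ + W₂) + C₁ * W₂) := by
    intro s
    have h2 : H 2 s = (g₂ (U s + W s) * ((U₁ s + V₁ s : ℝ) : ℂ) ^ 2 + g₁ (U s + W s) * ((U₂ s + V₂ s : ℝ) : ℂ)) -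
        (g₂ (U s) * (U₁ s : ℂ) ^ 2 + g₁ (U s) * (U₂ s : ℂ)) := by simp [hH]
    rw [h2]
    by_cases hs : |e s| ≤ E₀
    · obtain ⟨bU₁, bU₂, -, bW, bV₁, bV₂, -⟩ := profileIncr_curves_bounds hE₁ hE₂ hE₃ hP₀ hP₁ hP₂ hP₃ hs
      rw [← hD₁] at bU₁; rw [← hD₂] at bU₂; rw [← hW₀] at bW; rw [← hW₁] at bV₁; rw [← hW₂] at bV₂
      exact norm_comp_incr_deriv2_le h₁ h₂ j₁ j₂ bU₁ bU₂ bW bV₁ bV₂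
    · have z1 := (far s hs 1).1; have z2 := (far s hs 1).2; have z3 := (far s hs 2).1; have z4 := (far s hs 2).2
      have : (g₂ (U s + W s) * ((U₁ s + V₁ s : ℝ) : ℂ) ^ 2 + g₁ (U s + W s) * ((U₂ s + V₂ s : ℝ) : ℂ)) -
          (g₂ (U s) * (U₁ s : ℂ) ^ 2 + g₁ (U s) * (U₂ s : ℂ)) = 0 := by simp only [hg₁, hg₂, z1, z2, z3, z4]; simp
      rw [this, norm_zero]; positivity
  have B3 : ∀ s, ‖H 3 s‖ ≤ C₄ * W₀ * (D₁ + W₁) ^ 3 + C₃ * (W₁ * (3 * D₁ ^ 2 + 3 * D₁ * W₁ + W₁ ^ 2)) +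
      3 * (C₃ * W₀ * ((D₁ + W₁) * (D₂ + W₂)) + C₂ * (D₁ * W₂ + W₁ * D₂ + W₁ * W₂)) + (C₂ * W₀ * (D₃ + W₃) + C₁ * W₃) := by
    intro s
    have h3 : H 3 s = (g₃ (U s + W s) * ((U₁ s + V₁ s : ℝ) : ℂ) ^ 3 + 3 * (g₂ (U s + W s) * ((U₁ s + V₁ s : ℝ) : ℂ) *
          ((U₂ s + V₂ s : ℝ) : ℂ)) + g₁ (U s + W s) * ((U₃ s + V₃ s : ℝ) : ℂ)) -
        (g₃ (U s) * (U₁ s : ℂ) ^ 3 + 3 * (g₂ (U s) * (U₁ s : ℂ) * (U₂ s : ℂ)) + g₁ (U s) * (U₃ s : ℂ)) := by simp [hH]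
    rw [h3]
    by_cases hs : |e s| ≤ E₀
    · obtain ⟨bU₁, bU₂, bU₃, bW, bV₁, bV₂, bV₃⟩ := profileIncr_curves_bounds hE₁ hE₂ hE₃ hP₀ hP₁ hP₂ hP₃ hs
      rw [← hD₁] at bU₁; rw [← hD₂] at bU₂; rw [← hD₃] at bU₃; rw [← hW₀] at bW; rw [← hW₁] at bV₁; rw [← hW₂] at bV₂
      rw [← hW₃] at bV₃
      exact norm_comp_incr_deriv3_le h₁ h₂ h₃ j₁ j₂ j₃ bU₁ bU₂ bU₃ bW bV₁ bV₂ bV₃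
    · have z1 := (far s hs 1).1; have z2 := (far s hs 1).2; have z3 := (far s hs 2).1; have z4 := (far s hs 2).2
      have z5 := (far s hs 3).1; have z6 := (far s hs 3).2
      have : (g₃ (U s + W s) * ((U₁ s + V₁ s : ℝ) : ℂ) ^ 3 + 3 * (g₂ (U s + W s) * ((U₁ s + V₁ s : ℝ) : ℂ) *
          ((U₂ s + V₂ s : ℝ) : ℂ)) + g₁ (U s + W s) * ((U₃ s + V₃ s : ℝ) : ℂ)) -
          (g₃ (U s) * (U₁ s : ℂ) ^ 3 + 3 * (g₂ (U s) * (U₁ s : ℂ) * (U₂ s : ℂ)) + g₁ (U s) * (U₃ s : ℂ)) = 0 := by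
        simp only [hg₁, hg₂, hg₃, z1, z2, z3, z4, z5, z6]; simp
      rw [this, norm_zero]; positivity
  -- the four conclusions
  refine ⟨?_, ?_, ?_, ?_⟩
  · have h := B0 t
    have e0 : H 0 t = ((bgmCutoffSq e₀ ((16 : ℝ) ^ n * (k₀ ^ 2 + (e t - ν t) ^ 2)) : ℝ) : ℂ) -
        ((bgmCutoffSq e₀ ((16 : ℝ) ^ n * (k₀ ^ 2 + e t ^ 2)) : ℝ) : ℂ) := by rw [← hI]
    rw [e0] at h; exact h
  · have h := Literature.Analysis.norm_fwdDiff_iter_le_of_hasDerivAt hδ 1 H t (C₂ * W₀ * (D₁ + W₁) + C₁ * W₁)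
      (fun k hk s _ => hchain k (by omega) s) (fun s _ => B1 s)
    rw [hI, ← Function.iterate_one (fwdDiff δ)]
    simpa only [pow_one] using h
  · have h := Literature.Analysis.norm_fwdDiff_iter_le_of_hasDerivAt hδ 2 H t
      (C₃ * W₀ * (D₁ + W₁) ^ 2 + C₂ * (W₁ * (2 * D₁ + W₁)) + (C₂ * W₀ * (D₂ + W₂) + C₁ * W₂))
      (fun k hk s _ => hchain k (by omega) s) (fun s _ => B2 s)
    rw [hI]; exact h
  · have h := Literature.Analysis.norm_fwdDiff_iter_le_of_hasDerivAt hδ 3 H t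
      (C₄ * W₀ * (D₁ + W₁) ^ 3 + C₃ * (W₁ * (3 * D₁ ^ 2 + 3 * D₁ * W₁ + W₁ ^ 2)) +
        3 * (C₃ * W₀ * ((D₁ + W₁) * (D₂ + W₂)) + C₂ * (D₁ * W₂ + W₁ * D₂ + W₁ * W₂)) + (C₂ * W₀ * (D₃ + W₃) + C₁ * W₃))
      (fun k hk s _ => hchain k hk s) (fun s _ => B3 s)
    rw [hI]; exact h

end ProfileIncr

end Summit.HubbardSuperconductivity.HubbardSuperconductivity.Theorems.TorusFourierL2

end
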